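import Literature.MathematicalPhysics.QuantumFieldTheory.SUNBakryEmeryLogSobolev
import Literature.MathematicalPhysics.QuantumFieldTheory.SUNBakryEmeryWeierstrass
import Mathlib.Analysis.Calculus.BumpFunction.FiniteDimension
import Mathlib.MeasureTheory.Integral.DominatedConvergence
import HarnessLib

/-!
# The Bakry–Émery log-Sobolev inequality for the Haar measure of `SU(N)`: all smooth functions

Extension of `logSobolev_poly` (polynomial test functions) to every smooth ambient function `u : M_N(ℂ) → ℝ`
(`logSobolev_haar`), completing the `SU(N)` instance of Bakry–Gentil–Ledoux, Prop. 5.7.1 (`LS(2/N)` for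
`(SU(N), σ, Γ)`, `Γ(u,u) = ∑_α (D_α u)²`, `ρ = Ric = N/2`), i.e. Shen–Zhu–Zhu's log-Sobolev inequality (4.12) at `β = 0` for
one link, for the natural class of smooth observables:

  `Ent_σ(u²) = ∫ u² log u² dσ − (∫ u² dσ) log(∫ u² dσ) ≤ (4/N) ∫ Γ(u,u) dσ`.

Proof: cut `u` off smoothly outside a ball containing `SU(N)` (a `ContDiffBump`), approximate in `C¹` on `SU(N)` by
polynomials (`exists_poly_approx_C1`, Landau–Lang), apply `logSobolev_poly`, and pass to the limit by dominated
convergence.  Theorems only; no definition.  Nothing here concerns the Yang–Mills mass gap.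

## References

* D. Bakry, I. Gentil, M. Ledoux, *Analysis and Geometry of Markov Diffusion Operators* (2014), Prop. 5.7.1.
* H. Shen, R. Zhu, X. Zhu, CMP 400 (2023) 805–851, Thm. 4.2, Cor. 4.4 (4.12).
* S. Lang, *Math Talks for Undergraduates* (1999), pp. 36–38.
-/

noncomputable section

open scoped Matrix ComplexConjugate BigOperators

namespace Literature.MathematicalPhysics.QuantumFieldTheory

namespace SUNBakryEmery

open scoped Matrix.Norms.Frobenius ContDiff Topology
open Matrix Complex Finset MeasureTheory Filter Set Metric

variable {N : ℕ}

/-- A smooth compactly supported modification of `u` which agrees with `u` near `SU(N)`: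
`v = χ·u` with `χ` a smooth bump equal to `1` on a ball containing `SU(N)`; `v ∈ C¹`, `v = 0` outside a larger ball,
and `v = u`, `D_α v = D_α u` on `SU(N)`. [cite: Lang1999MathTalks, Dirac sequences p. 36–37 (proof device)] -/
theorem exists_cutoff (u : Matrix (Fin N) (Fin N) ℂ → ℝ) (hu : ContDiff ℝ ∞ u) :
    ∃ (v : Matrix (Fin N) (Fin N) ℂ → ℝ) (r₂ : ℝ), 0 < r₂ ∧ ContDiff ℝ 1 v ∧ (∀ y, r₂ < ‖y‖ → v y = 0) ∧
      (∀ g : SUN N, v g = u g) ∧ ∀ (g : SUN N) (A : Matrix (Fin N) (Fin N) ℂ), matD A v g = matD A u g := by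
  obtain ⟨C₀, hC₀⟩ := isCompact_univ.exists_bound_of_continuousOn
    ((continuous_subtype_val (p := fun Q : Matrix (Fin N) (Fin N) ℂ =>
      Q ∈ Matrix.specialUnitaryGroup (Fin N) ℂ)).norm.continuousOn)
  set r₀ : ℝ := |C₀| + 1 with hr₀
  have hr₀0 : 0 < r₀ := by positivity
  have hgr₀ : ∀ g : SUN N, ‖(g : Matrix (Fin N) (Fin N) ℂ)‖ < r₀ := fun g => by
    have h := hC₀ g (mem_univ _)
    rw [norm_norm] at h
    rw [hr₀]; linarith [le_abs_self C₀]
  let χ : ContDiffBump (0 : Matrix (Fin N) (Fin N) ℂ) := ⟨r₀, r₀ + 1, hr₀0, by linarith⟩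
  refine ⟨fun x => χ x * u x, r₀ + 1, by linarith, ?_, ?_, ?_, ?_⟩
  · exact (χ.contDiff (n := 1)).mul (hu.of_le (by norm_cast))
  · intro y hy
    have : χ y = 0 := χ.zero_of_le_dist (by rw [dist_zero_right]; exact hy.le)
    simp [this]
  · intro g
    have : χ g = 1 := χ.one_of_mem_closedBall (by rw [mem_closedBall, dist_zero_right]; exact (hgr₀ g).le)
    simp [this]
  · intro g A
    have hev : (fun x => χ x * u x) =ᶠ[𝓝 (g : Matrix (Fin N) (Fin N) ℂ)] u := by
      have hopen : IsOpen (ball (0 : Matrix (Fin N) (Fin N) ℂ) r₀) := isOpen_ball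
      filter_upwards [hopen.mem_nhds (mem_ball_zero_iff.2 (hgr₀ g))] with x hx
      have : χ x = 1 := χ.one_of_mem_closedBall (ball_subset_closedBall hx)
      simp [this]
    rw [matD_apply, matD_apply]
    exact congrArg (fun L : Matrix (Fin N) (Fin N) ℂ →L[ℝ] ℝ => L ((g : Matrix (Fin N) (Fin N) ℂ) * A)) hev.fderiv_eq

/-- Dominated convergence on `SU(N)` for a uniformly convergent sequence composed with a continuous function:
if `|F_m(g) − f(g)| ≤ 1/(m+1)` on `SU(N)`, `f` is bounded by `B₀` there, `φ` is continuous and each `F_m`, `f` is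
continuous on `SU(N)`, then `∫ φ(F_m) dσ → ∫ φ(f) dσ`. [cite: BakryGentilLedoux2014, Prop. 5.7.1 (extension to the Dirichlet domain; proof device)] -/
theorem tendsto_integral_comp_of_uniform {F : ℕ → SUN N → ℝ} {f : SUN N → ℝ} (hF : ∀ m, Continuous (F m))
    (hf : Continuous f) (hclose : ∀ m g, |F m g - f g| ≤ 1 / ((m : ℝ) + 1)) {φ : ℝ → ℝ} (hφ : Continuous φ) :
    Tendsto (fun m => ∫ g, φ (F m g) ∂(haarSU N)) atTop (𝓝 (∫ g, φ (f g) ∂(haarSU N))) := by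
  obtain ⟨B₀, hB₀⟩ := isCompact_univ.exists_bound_of_continuousOn hf.continuousOn
  obtain ⟨B, hB⟩ := (isCompact_Icc (a := -(‖B₀‖ + 1)) (b := ‖B₀‖ + 1)).exists_bound_of_continuousOn hφ.continuousOn
  have hmem : ∀ m g, F m g ∈ Icc (-(‖B₀‖ + 1)) (‖B₀‖ + 1) := by
    intro m g
    have h1 := hclose m g
    have h2 : |f g| ≤ ‖B₀‖ := by
      have := hB₀ g (mem_univ _); rw [Real.norm_eq_abs] at this; exact this.trans (le_abs_self _)
    have h3 : 1 / ((m : ℝ) + 1) ≤ 1 := by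
      rw [div_le_one (by positivity)]; linarith [(Nat.cast_nonneg m : (0 : ℝ) ≤ m)]
    rw [abs_le] at h1 h2
    constructor <;> linarith
  refine tendsto_integral_of_dominated_convergence (fun _ => B) (fun m => ((hφ.comp (hF m))).aestronglyMeasurable)
    (integrable_const B) (fun m => ae_of_all _ fun g => hB _ (hmem m g)) (ae_of_all _ fun g => ?_)
  have hlim : Tendsto (fun m => F m g) atTop (𝓝 (f g)) := by
    have h0 : Tendsto (fun m : ℕ => 1 / ((m : ℝ) + 1)) atTop (𝓝 0) := tendsto_one_div_add_atTop_nhds_zero_nat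
    rw [tendsto_iff_norm_sub_tendsto_zero]
    exact squeeze_zero (fun m => norm_nonneg _) (fun m => by rw [Real.norm_eq_abs]; exact hclose m g) h0
  exact (hφ.tendsto _).comp hlim

/-- ★★ **The Bakry–Émery logarithmic Sobolev inequality for the Haar probability measure of `SU(N)`, smooth functions**
(BGL Prop. 5.7.1 with `ρ = Ric = N/2`; Shen–Zhu–Zhu Thm. 4.2 / (4.12) at `β = 0`, one link, `K_S = N/2`): for `N ≥ 1` and
every smooth ambient `u : M_N(ℂ) → ℝ`,
`∫ u² log u² dσ − (∫ u² dσ) log(∫ u² dσ) ≤ (4/N) ∫ Γ(u,u) dσ`, `Γ(u,u) = ∑_α (D_α u)²`.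
From `logSobolev_poly` by `C¹` approximation on `SU(N)` (`exists_poly_approx_C1`) and dominated convergence.
[cite: BakryGentilLedoux2014, Prop. 5.7.1] [cite: ShenZhuZhuCMP2023, Theorem 4.2 (4.12), β = 0] -/
theorem logSobolev_haar (hN : N ≠ 0) {u : Matrix (Fin N) (Fin N) ℂ → ℝ} (hu : ContDiff ℝ ∞ u) :
    ∫ g : SUN N, u g ^ 2 * Real.log (u g ^ 2) ∂(haarSU N) -
        (∫ g : SUN N, u g ^ 2 ∂(haarSU N)) * Real.log (∫ g : SUN N, u g ^ 2 ∂(haarSU N)) ≤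
      4 / (N : ℝ) * ∫ g : SUN N, Gam u u g ∂(haarSU N) := by
  classical
  set σ := haarSU N with hσ
  obtain ⟨v, r₂, hr₂, hv, hvr, hvu, hdvu⟩ := exists_cutoff u hu
  -- polynomial approximants `P m`, `1/(m+1)`-close in `C¹` on `SU(N)`
  have hex : ∀ m : ℕ, ∃ P : Matrix (Fin N) (Fin N) ℂ → ℝ, (∃ n, P ∈ polySpace N n) ∧
      (∀ g : SUN N, |P g - u g| ≤ 1 / ((m : ℝ) + 1)) ∧
      ∀ (g : SUN N) (α : FrameIdx N), |matD (frame α) P g - matD (frame α) u g| ≤ 1 / ((m : ℝ) + 1) := by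
    intro m
    obtain ⟨n, P, hPn, hP1, hP2⟩ := exists_poly_approx_C1 hv hr₂ hvr (ε := 1 / ((m : ℝ) + 1)) (by positivity)
    refine ⟨P, ⟨n, hPn⟩, fun g => ?_, fun g α => ?_⟩
    · rw [← hvu g]; exact hP1 g g.2
    · rw [← hdvu g]; exact hP2 g g.2 α
  choose P hPmem hPval hPder using hex
  -- continuity data
  have huc : Continuous fun g : SUN N => u g := continuous_restrict hu
  have hPs : ∀ m, ContDiff ℝ ∞ (P m) := fun m => contDiff_of_mem_polySpace (hPmem m).choose_spec
  have hPc : ∀ m, Continuous fun g : SUN N => P m g := fun m => continuous_restrict (hPs m)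
  have hduc : ∀ α, Continuous fun g : SUN N => matD (frame α) u g := fun α => continuous_restrict (contDiff_matD hu _)
  have hdPc : ∀ m α, Continuous fun g : SUN N => matD (frame α) (P m) g :=
    fun m α => continuous_restrict (contDiff_matD (hPs m) _)
  -- the inequality for each `P m`
  have hLSm : ∀ m, ∫ g : SUN N, P m g ^ 2 * Real.log (P m g ^ 2) ∂σ -
      (∫ g : SUN N, P m g ^ 2 ∂σ) * Real.log (∫ g : SUN N, P m g ^ 2 ∂σ) ≤ 4 / (N : ℝ) * ∫ g : SUN N, Gam (P m) (P m) g ∂σ :=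
    fun m => logSobolev_poly hN (hPmem m).choose_spec
  -- limits of the three integrals
  have h1 : Tendsto (fun m => ∫ g : SUN N, P m g ^ 2 * Real.log (P m g ^ 2) ∂σ) atTop
      (𝓝 (∫ g : SUN N, u g ^ 2 * Real.log (u g ^ 2) ∂σ)) :=
    tendsto_integral_comp_of_uniform (φ := fun x => x ^ 2 * Real.log (x ^ 2)) (hPc) huc hPval
      (Real.continuous_mul_log.comp (continuous_pow 2))
  have h2 : Tendsto (fun m => ∫ g : SUN N, P m g ^ 2 ∂σ) atTop (𝓝 (∫ g : SUN N, u g ^ 2 ∂σ)) :=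
    tendsto_integral_comp_of_uniform (φ := fun x => x ^ 2) hPc huc hPval (continuous_pow 2)
  have h3 : Tendsto (fun m => (∫ g : SUN N, P m g ^ 2 ∂σ) * Real.log (∫ g : SUN N, P m g ^ 2 ∂σ)) atTop
      (𝓝 ((∫ g : SUN N, u g ^ 2 ∂σ) * Real.log (∫ g : SUN N, u g ^ 2 ∂σ))) :=
    (Real.continuous_mul_log.tendsto _).comp h2
  -- limit of the energies: `Γ = ∑_α (D_α ·)²`, dominated convergence termwise
  have h4 : Tendsto (fun m => ∫ g : SUN N, Gam (P m) (P m) g ∂σ) atTop (𝓝 (∫ g : SUN N, Gam u u g ∂σ)) := by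
    have hG : ∀ (F : Matrix (Fin N) (Fin N) ℂ → ℝ) (g : SUN N), Gam F F g = ∑ α, matD (frame α) F g ^ 2 :=
      fun F g => Gam_self_eq_sum_sq F g
    simp_rw [hG]
    have hint : ∀ (m) (α : FrameIdx N), Integrable (fun g : SUN N => matD (frame α) (P m) g ^ 2) σ :=
      fun m α => integrable_of_continuous_SUN ((hdPc m α).pow 2) _
    have hintu : ∀ α : FrameIdx N, Integrable (fun g : SUN N => matD (frame α) u g ^ 2) σ :=
      fun α => integrable_of_continuous_SUN ((hduc α).pow 2) _
    have e1 : ∀ m, ∫ g : SUN N, ∑ α, matD (frame α) (P m) g ^ 2 ∂σ = ∑ α, ∫ g : SUN N, matD (frame α) (P m) g ^ 2 ∂σ :=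
      fun m => integral_finsetSum _ fun α _ => hint m α
    have e2 : ∫ g : SUN N, ∑ α, matD (frame α) u g ^ 2 ∂σ = ∑ α, ∫ g : SUN N, matD (frame α) u g ^ 2 ∂σ :=
      integral_finsetSum _ fun α _ => hintu α
    simp_rw [e1, e2]
    refine tendsto_finsetSum _ fun α _ => ?_
    exact tendsto_integral_comp_of_uniform (φ := fun x => x ^ 2) (fun m => hdPc m α) (hduc α)
      (fun m g => hPder m g α) (continuous_pow 2)
  -- conclude
  have hleft := h1.sub h3
  have hright := h4.const_mul (4 / (N : ℝ))
  exact le_of_tendsto_of_tendsto' hleft hright hLSm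

/-- **Log-Sobolev inequality for the Haar measure of `SU(N)`, Lipschitz form** (the shape of Shen–Zhu–Zhu's Cor. 4.5 /
(4.12) used in the tree, cf. `shenZhuZhu_functionalInequalities`, here at `β = 0` for one link): for a smooth ambient `u` which
is `M`-Lipschitz for the Frobenius distance, `Ent_σ(u²) ≤ (4/N) M²` (`Γ(u,u) ≤ M²` on `SU(N)`, `Gam_self_le_of_lipschitz`).
[cite: ShenZhuZhuCMP2023, Corollary 4.5 (4.12), β = 0] [cite: BakryGentilLedoux2014, Prop. 5.7.1] -/
theorem logSobolev_haar_lipschitz (hN : N ≠ 0) {u : Matrix (Fin N) (Fin N) ℂ → ℝ} (hu : ContDiff ℝ ∞ u) {M : NNReal}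
    (hlip : LipschitzWith M u) :
    ∫ g : SUN N, u g ^ 2 * Real.log (u g ^ 2) ∂(haarSU N) -
        (∫ g : SUN N, u g ^ 2 ∂(haarSU N)) * Real.log (∫ g : SUN N, u g ^ 2 ∂(haarSU N)) ≤
      4 / (N : ℝ) * (M : ℝ) ^ 2 := by
  refine (logSobolev_haar hN hu).trans (mul_le_mul_of_nonneg_left ?_ (by positivity))
  have h := integral_mono (integrable_of_continuous_SUN (continuous_restrict (contDiff_Gam hu hu)) (haarSU N))
    (integrable_const ((M : ℝ) ^ 2)) fun g : SUN N => Gam_self_le_of_lipschitz hN hlip (SUN.mem_unitaryGroup g)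
  simpa using h

/-! ### The `C¹` class -/

/-- `C¹` version of `exists_cutoff`: a `C¹` compactly supported modification of `u` which agrees with `u` near `SU(N)`:
`v = χ·u` with `χ` a smooth bump equal to `1` on a ball containing `SU(N)`; `v ∈ C¹`, `v = 0` outside a larger ball,
and `v = u`, `D_α v = D_α u` on `SU(N)`. [cite: Lang1999MathTalks, Dirac sequences p. 36–37 (proof device)] -/
theorem exists_cutoff_of_contDiff_one (u : Matrix (Fin N) (Fin N) ℂ → ℝ) (hu : ContDiff ℝ 1 u) :
    ∃ (v : Matrix (Fin N) (Fin N) ℂ → ℝ) (r₂ : ℝ), 0 < r₂ ∧ ContDiff ℝ 1 v ∧ (∀ y, r₂ < ‖y‖ → v y = 0) ∧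
      (∀ g : SUN N, v g = u g) ∧ ∀ (g : SUN N) (A : Matrix (Fin N) (Fin N) ℂ), matD A v g = matD A u g := by
  obtain ⟨C₀, hC₀⟩ := isCompact_univ.exists_bound_of_continuousOn
    ((continuous_subtype_val (p := fun Q : Matrix (Fin N) (Fin N) ℂ =>
      Q ∈ Matrix.specialUnitaryGroup (Fin N) ℂ)).norm.continuousOn)
  set r₀ : ℝ := |C₀| + 1 with hr₀
  have hr₀0 : 0 < r₀ := by positivity
  have hgr₀ : ∀ g : SUN N, ‖(g : Matrix (Fin N) (Fin N) ℂ)‖ < r₀ := fun g => by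
    have h := hC₀ g (mem_univ _)
    rw [norm_norm] at h
    rw [hr₀]; linarith [le_abs_self C₀]
  let χ : ContDiffBump (0 : Matrix (Fin N) (Fin N) ℂ) := ⟨r₀, r₀ + 1, hr₀0, by linarith⟩
  refine ⟨fun x => χ x * u x, r₀ + 1, by linarith, ?_, ?_, ?_, ?_⟩
  · exact (χ.contDiff (n := 1)).mul hu
  · intro y hy
    have : χ y = 0 := χ.zero_of_le_dist (by rw [dist_zero_right]; exact hy.le)
    simp [this]
  · intro g
    have : χ g = 1 := χ.one_of_mem_closedBall (by rw [mem_closedBall, dist_zero_right]; exact (hgr₀ g).le)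
    simp [this]
  · intro g A
    have hev : (fun x => χ x * u x) =ᶠ[𝓝 (g : Matrix (Fin N) (Fin N) ℂ)] u := by
      have hopen : IsOpen (ball (0 : Matrix (Fin N) (Fin N) ℂ) r₀) := isOpen_ball
      filter_upwards [hopen.mem_nhds (mem_ball_zero_iff.2 (hgr₀ g))] with x hx
      have : χ x = 1 := χ.one_of_mem_closedBall (ball_subset_closedBall hx)
      simp [this]
    rw [matD_apply, matD_apply]
    exact congrArg (fun L : Matrix (Fin N) (Fin N) ℂ →L[ℝ] ℝ => L ((g : Matrix (Fin N) (Fin N) ℂ) * A)) hev.fderiv_eq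

/-- ★★ **The Bakry–Émery logarithmic Sobolev inequality for the Haar probability measure of `SU(N)`, `C¹` functions**
(BGL Prop. 5.7.1 with `ρ = Ric = N/2`; Shen–Zhu–Zhu Thm. 4.2 / (4.12) at `β = 0`, one link, `K_S = N/2`): for `N ≥ 1` and
every `C¹` ambient `u : M_N(ℂ) → ℝ` (the regularity class of `KernelLogSobolev`),
`∫ u² log u² dσ − (∫ u² dσ) log(∫ u² dσ) ≤ (4/N) ∫ Γ(u,u) dσ`, `Γ(u,u) = ∑_α (D_α u)²`.
From `logSobolev_poly` by `C¹` approximation on `SU(N)` (`exists_poly_approx_C1`) and dominated convergence.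
[cite: BakryGentilLedoux2014, Prop. 5.7.1] [cite: ShenZhuZhuCMP2023, Theorem 4.2 (4.12), β = 0] -/
theorem logSobolev_haar_of_contDiff_one (hN : N ≠ 0) {u : Matrix (Fin N) (Fin N) ℂ → ℝ} (hu : ContDiff ℝ 1 u) :
    ∫ g : SUN N, u g ^ 2 * Real.log (u g ^ 2) ∂(haarSU N) -
        (∫ g : SUN N, u g ^ 2 ∂(haarSU N)) * Real.log (∫ g : SUN N, u g ^ 2 ∂(haarSU N)) ≤
      4 / (N : ℝ) * ∫ g : SUN N, Gam u u g ∂(haarSU N) := by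
  classical
  set σ := haarSU N with hσ
  obtain ⟨v, r₂, hr₂, hv, hvr, hvu, hdvu⟩ := exists_cutoff_of_contDiff_one u hu
  -- polynomial approximants `P m`, `1/(m+1)`-close in `C¹` on `SU(N)`
  have hex : ∀ m : ℕ, ∃ P : Matrix (Fin N) (Fin N) ℂ → ℝ, (∃ n, P ∈ polySpace N n) ∧
      (∀ g : SUN N, |P g - u g| ≤ 1 / ((m : ℝ) + 1)) ∧
      ∀ (g : SUN N) (α : FrameIdx N), |matD (frame α) P g - matD (frame α) u g| ≤ 1 / ((m : ℝ) + 1) := by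
    intro m
    obtain ⟨n, P, hPn, hP1, hP2⟩ := exists_poly_approx_C1 hv hr₂ hvr (ε := 1 / ((m : ℝ) + 1)) (by positivity)
    refine ⟨P, ⟨n, hPn⟩, fun g => ?_, fun g α => ?_⟩
    · rw [← hvu g]; exact hP1 g g.2
    · rw [← hdvu g]; exact hP2 g g.2 α
  choose P hPmem hPval hPder using hex
  -- continuity data
  have huc : Continuous fun g : SUN N => u g := hu.continuous.comp continuous_subtype_val
  have hPs : ∀ m, ContDiff ℝ ∞ (P m) := fun m => contDiff_of_mem_polySpace (hPmem m).choose_spec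
  have hPc : ∀ m, Continuous fun g : SUN N => P m g := fun m => continuous_restrict (hPs m)
  have hduc : ∀ α, Continuous fun g : SUN N => matD (frame α) u g := fun α => by
    show Continuous fun g : SUN N => fderiv ℝ u g ((g : Matrix (Fin N) (Fin N) ℂ) * frame α)
    exact (hu.continuous_fderiv_apply one_ne_zero).comp
      (continuous_subtype_val.prodMk (continuous_subtype_val.mul continuous_const))
  have hdPc : ∀ m α, Continuous fun g : SUN N => matD (frame α) (P m) g :=
    fun m α => continuous_restrict (contDiff_matD (hPs m) _)
  -- the inequality for each `P m`
  have hLSm : ∀ m, ∫ g : SUN N, P m g ^ 2 * Real.log (P m g ^ 2) ∂σ -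
      (∫ g : SUN N, P m g ^ 2 ∂σ) * Real.log (∫ g : SUN N, P m g ^ 2 ∂σ) ≤ 4 / (N : ℝ) * ∫ g : SUN N, Gam (P m) (P m) g ∂σ :=
    fun m => logSobolev_poly hN (hPmem m).choose_spec
  -- limits of the three integrals
  have h1 : Tendsto (fun m => ∫ g : SUN N, P m g ^ 2 * Real.log (P m g ^ 2) ∂σ) atTop
      (𝓝 (∫ g : SUN N, u g ^ 2 * Real.log (u g ^ 2) ∂σ)) :=
    tendsto_integral_comp_of_uniform (φ := fun x => x ^ 2 * Real.log (x ^ 2)) (hPc) huc hPval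
      (Real.continuous_mul_log.comp (continuous_pow 2))
  have h2 : Tendsto (fun m => ∫ g : SUN N, P m g ^ 2 ∂σ) atTop (𝓝 (∫ g : SUN N, u g ^ 2 ∂σ)) :=
    tendsto_integral_comp_of_uniform (φ := fun x => x ^ 2) hPc huc hPval (continuous_pow 2)
  have h3 : Tendsto (fun m => (∫ g : SUN N, P m g ^ 2 ∂σ) * Real.log (∫ g : SUN N, P m g ^ 2 ∂σ)) atTop
      (𝓝 ((∫ g : SUN N, u g ^ 2 ∂σ) * Real.log (∫ g : SUN N, u g ^ 2 ∂σ))) :=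
    (Real.continuous_mul_log.tendsto _).comp h2
  -- limit of the energies: `Γ = ∑_α (D_α ·)²`, dominated convergence termwise
  have h4 : Tendsto (fun m => ∫ g : SUN N, Gam (P m) (P m) g ∂σ) atTop (𝓝 (∫ g : SUN N, Gam u u g ∂σ)) := by
    have hG : ∀ (F : Matrix (Fin N) (Fin N) ℂ → ℝ) (g : SUN N), Gam F F g = ∑ α, matD (frame α) F g ^ 2 :=
      fun F g => Gam_self_eq_sum_sq F g
    simp_rw [hG]
    have hint : ∀ (m) (α : FrameIdx N), Integrable (fun g : SUN N => matD (frame α) (P m) g ^ 2) σ :=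
      fun m α => integrable_of_continuous_SUN ((hdPc m α).pow 2) _
    have hintu : ∀ α : FrameIdx N, Integrable (fun g : SUN N => matD (frame α) u g ^ 2) σ :=
      fun α => integrable_of_continuous_SUN ((hduc α).pow 2) _
    have e1 : ∀ m, ∫ g : SUN N, ∑ α, matD (frame α) (P m) g ^ 2 ∂σ = ∑ α, ∫ g : SUN N, matD (frame α) (P m) g ^ 2 ∂σ :=
      fun m => integral_finsetSum _ fun α _ => hint m α
    have e2 : ∫ g : SUN N, ∑ α, matD (frame α) u g ^ 2 ∂σ = ∑ α, ∫ g : SUN N, matD (frame α) u g ^ 2 ∂σ :=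
      integral_finsetSum _ fun α _ => hintu α
    simp_rw [e1, e2]
    refine tendsto_finsetSum _ fun α _ => ?_
    exact tendsto_integral_comp_of_uniform (φ := fun x => x ^ 2) (fun m => hdPc m α) (hduc α)
      (fun m g => hPder m g α) (continuous_pow 2)
  -- conclude
  have hleft := h1.sub h3
  have hright := h4.const_mul (4 / (N : ℝ))
  exact le_of_tendsto_of_tendsto' hleft hright hLSm

end SUNBakryEmery

end Literature.MathematicalPhysics.QuantumFieldTheory
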